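import Summits.BirchSwinnertonDyer.BirchSwinnertonDyer.Theses.AdditiveKolyvaginRoad
import Summits.BirchSwinnertonDyer.BirchSwinnertonDyer.Theorems.SemiOrdinaryEisensteinDescentShaTwoCochainShell
import Summits.BirchSwinnertonDyer.BirchSwinnertonDyer.Theorems.SemiOrdinaryEisensteinDescentShaTwoCochainBridgeAssemblyCriterion
import Summits.BirchSwinnertonDyer.BirchSwinnertonDyer.Theorems.SemiOrdinaryEisensteinDescentShaTwoCochainClassReadout
import Summits.BirchSwinnertonDyer.BirchSwinnertonDyer.Theorems.SchneiderFreeAdditiveX3PoitouTateSelmerDualityHolds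
import HarnessLib

set_option linter.dupNamespace false -- `…BirchSwinnertonDyer.BirchSwinnertonDyer…` is the cell's nested layout (D-0017)
set_option autoImplicit false

/-!
# Item 21333 `PublishedDualityInputsAdditiveKoly` (route `AdditiveKolyvaginRoad`, aside 9) — PROVED BY NAME
# (post-Cassels–Tate propagation packet of the SOED Kolyvagin-column width seat bsd-wall-soed-p2-w2 g12, 2026-08-28)

Width seat `bsd-wall-soed-p2-w2` (gen 12, lead-of-record lineage of SOED crux J‴ 25898; explicit unit, no claim),
`--workitem stmt-BirchSwinnertonDyer-21333`. THEOREMS ONLY (no definition, no named fact, no `sorry`).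

The item is the by-name bundle of the two published DUALITY inputs displayed by route `AdditiveKolyvaginRoad`
(second tranche of its published inputs, T12 shape):

  `(∀ K, casselsTate_levelInputs K) ∧ (∀ K, poitouTate_selmerStructure_duality K)`.

BOTH conjuncts are tree theorems as of 2026-08-28:
* conjunct 1 — the levelwise Cassels–Tate inputs for THE canonical local invariant maps at every number field
  (Milne *ADT* I §6 Prop. 6.9 / Thm. 6.13 with I Thm. 4.10 (a)(c); Cassels 1962; Tate 1962; Gross 1991 §5 (5.1)
  equivariance): `ShaTwoCochainTheta.casselsTate_levelInputs_of_shaTwoCochainBridge` (p648480, the CT-20191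
  Ш²-cochain bridge of the SOED Kolyvagin-column width seats, file
  `Theorems/SemiOrdinaryEisensteinDescentShaTwoCochainCasselsTate.lean`; item 20191 CLOSED·proved 2026-08-28T16:30:59Z);
* conjunct 2 — Poitou–Tate duality for Selmer structures over every number field (Milne *ADT* I Thm. 4.10 (b);
  Howard 2004 Thm. 2.1.11; Rubin *Euler Systems* Thm. 1.7.3):
  `SchneiderFreeAdditiveX3.PoitouTateReduction.poitouTate_selmerStructure_duality_holds` (cell `bsd-schneider`,
  p624636; the same theorem closes item 20461 on UTD/SOED via `InputsPoitouTateSelmer.…_proof`).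

This leaf file records the discharge against the route declaration by `unfold; exact ⟨_, _⟩`. Conjunct 1 is written as the
SAME three-constant term as p648480's `casselsTate_levelInputs_of_shaTwoCochainBridge`
(`casselsTate_levelInputs_of_readout_vanishing_flip K (hbridge_of_readout_criterion K (classBarInv_readout_eq_zero_of_criterion K))`),
imported from its three ROUTE-INDEPENDENT modules (`…ShaTwoCochainShell`, `…BridgeAssemblyCriterion`, `…ClassReadout`) rather than
from p648480's closer module, which imports four route files (`lint.theses-cone`). Nothing is re-derived; no landed declaration
is restated. Consequence inside `AdditiveKolyvaginRoad` (for its pen / the KPA′ 21400 lead, 0 ask):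
the parity stub P `stub_oddSelmerRankAdditive` of the registered lines is now closed MODULO THE THREE PUB CONJUNCTS ONLY
(Gross–Zagier, Kolyvagin, modularity) by `AdditiveKoly.oddSelmerRankAdditive_of_levelInputs hGZ hKo hmod
ShaTwoCochainTheta.casselsTate_levelInputs_of_shaTwoCochainBridge` (p557719's level-inputs twin), its DUAL.1 hypothesis gone.

Honest framing: UNCONDITIONAL (both conjuncts are kernel theorems with axioms {propext, Classical.choice, Quot.sound}).
Closing item 21333 removes one displayed print bundle of `AdditiveKolyvaginRoad` AS TYPED; no crux and no summit statement
is proved; Cassels–Tate and Poitou–Tate are PUBLISHED theorems discharged in the kernel; the Birch–Swinnerton-Dyer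
conjecture is NOT proved by any of this.
References: [MilneADT2006] Ch. I Thm. 4.10, §6 Prop. 6.9, Thm. 6.13; [Cassels1962ArithmeticIV]; [Tate1963DualityICM];
[Howard2004HeegnerKolyvagin] Thm. 2.1.11; [Rubin2000] Thm. 1.7.3; [GrossLMS1991] §5 (5.1).
-/

namespace Summit.BirchSwinnertonDyer.BirchSwinnertonDyer.Theorems.InputsSweep

open Literature.NumberTheory.EllipticCurves Literature.NumberTheory.GaloisCohomology

/-- **Item 21333 on route `AdditiveKolyvaginRoad` — `PublishedDualityInputsAdditiveKoly` PROVED (by name):**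
`(∀ K, casselsTate_levelInputs K) ∧ (∀ K, poitouTate_selmerStructure_duality K)` from the tree theorems of the CT-20191
Ш²-cochain bridge (`ShaTwoCochainTheta.casselsTate_levelInputs_of_readout_vanishing_flip` ∘ `hbridge_of_readout_criterion` ∘
`ShaTwoCochain.classBarInv_readout_eq_zero_of_criterion` — the term of p648480's `casselsTate_levelInputs_of_shaTwoCochainBridge`,
route-independent imports) and `SchneiderFreeAdditiveX3.PoitouTateReduction.poitouTate_selmerStructure_duality_holds` (p624636). Unconditional; closes
item 21333; BSD is not proved by this.
[cite: MilneADT2006, Ch. I, Thm. 4.10 (a)(b), §6 Prop. 6.9, Thm. 6.13 (a)(b)] [cite: Cassels1962ArithmeticIV]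
[cite: Tate1963DualityICM] [cite: Howard2004HeegnerKolyvagin, Thm. 2.1.11 (arXiv:1202.6340 p. 6)] -/
theorem additiveKolyvaginRoad_publishedDualityInputsAdditiveKoly_proof :
    Summit.BirchSwinnertonDyer.BirchSwinnertonDyer.Theses.AdditiveKolyvaginRoad.PublishedDualityInputsAdditiveKoly := by
  unfold Summit.BirchSwinnertonDyer.BirchSwinnertonDyer.Theses.AdditiveKolyvaginRoad.PublishedDualityInputsAdditiveKoly
  exact ⟨fun K _ _ => ShaTwoCochainTheta.casselsTate_levelInputs_of_readout_vanishing_flip K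
      (ShaTwoCochainTheta.hbridge_of_readout_criterion K (ShaTwoCochain.classBarInv_readout_eq_zero_of_criterion K)),
    fun K _ _ => SchneiderFreeAdditiveX3.PoitouTateReduction.poitouTate_selmerStructure_duality_holds K⟩

end Summit.BirchSwinnertonDyer.BirchSwinnertonDyer.Theorems.InputsSweep
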